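import Literature.AlgebraicGeometry.Frobenioids.ArchimedeanRationallyStandard
import Literature.AlgebraicGeometry.Frobenioids.ArchimedeanNotRationallyStandard
import Literature.AlgebraicGeometry.Frobenioids.ArchimedeanPointBaseProp35
import HarnessLib

/-!
# Frobenioids II, Theorem 3.6 (i)/(ii), last clauses («rationally standard» / «standard but not rationally
# standard»): the universal closures of the typed SCHEMATA `ArchFrd.Thm36i_rationallyStandard G F R`,
# `ArchFrd.Thm36ii_standard_notRationallyStandard G F R` are REFUTED in the kernel, and the printed
# instances hold with NO hypothesis at the archimedean Frobenioids of [IUTchI] Example 3.4 (i)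

Mochizuki, *The geometry of Frobenioids II: poly-Frobenioids*, Kyushu J. Math. **62** (2008) 401–460, §3,
Theorem 3.6 (i), kurims text p. 36 (last sentence): "If, moreover, `D` is of FSMFF- and RC-iso-subanchor
type, then `C^Λ` is of rationally standard type" [cite: MochizukiFrdII2008, Thm 3.6 (i) p.36]; Theorem 3.6
(ii), p. 37 ll. 3–5: "If, moreover, `D` is of FSMFF- and RC-iso-subanchor type, then `A` is of standard
[but not of rationally standard] type" [cite: MochizukiFrdII2008, Thm 3.6 (ii) p.37]; the base used at a
(complex) archimedean place in *Inter-universal Teichmüller theory I*, Example 3.4 (i), kurims text p. 80: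
"the one-morphism category determined by `Spec(K_v)`" [cite: Mochizuki2012, Ex 3.4 (i) p.80].

PROOF-ONLY companion (theorems only; no `def`, no `instance`) of `ArchimedeanStandardType.lean` (seat
abc-iut-L1-t9: the two schemata), `ArchimedeanRationallyStandard.lean` (abc-iut-L1-t9:
`thm36i_rationallyStandard_C/_pf/_rlf`), `ArchimedeanNotRationallyStandard.lean` (abc-iut-L1-t9:
`thm36ii_standard_notRationallyStandard_A`, `A.not_isOfRationallyStandardType_rsParams`) and
`ArchimedeanPointBaseProp35.lean` (abc-iut-w4-d027: the one-morphism base `ArchFrd.ptBase` is of FSMFF- and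
RC-iso-subanchor type); cell abc-iut, block F, FACT-LIST rows **F-0702** (`Thm36i_rationallyStandard`) and
**F-0703** (`Thm36ii_standard_notRationallyStandard`), class R5 ("parametrised schema: universal closure is
not a fact; named instances only"), seat abc-iut-f-013.

WHY THE CLOSURES ARE FALSE (an artefact of the typing, not of the paper). Both schemata bind the structure
functor `F : X → F_Φ` (and the [FrdI] Def. 4.5 (iii) parameter bundle `R`) FREELY and independently of the
base `G : D → D₀`; print asserts (i) of `F = C^Λ` and (ii) of `F = A` only. Over THE base of [IUTchI]
Ex. 3.4 (i) — the one-morphism category at `Spec ℂ`, which IS of FSMFF- and RC-iso-subanchor type — the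
angular Frobenioid `A` is NOT rationally standard (Thm. 3.6 (ii) itself), refuting the closure of (i), and
the archimedean Frobenioid `C` IS rationally standard (Thm. 3.6 (i) itself), refuting the closure of (ii):
each printed clause is the counterexample to the universal closure of the other.

CONTENTS.
* `Cpt.isOfRationallyStandardType`, `Cpt.pf_isOfRationallyStandardType`, `Cpt.rlf_isOfRationallyStandardType`
  — `C_v`, `C_v^pf = C_v^ℚ`, `C_v^rlf = C_v^ℝ` over the one-morphism base are of rationally standard type
  w.r.t. THE Def. 4.5 (iii) parameters, with NO hypothesis left (abc-iut-L1-t9's closers with Ex. 3.3 (i)'s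
  «connected, totally epimorphic» and the schema's antecedents «FSMFF, RC-iso-subanchor» all discharged at
  `ptBase`; the `Λ = ℤ` case was first elaborated as a non-vacuity probe by the second reader abc-iut-w5-d090,
  `AuditW5D090G4.Cpt_isOfRationallyStandardType`, and is recorded in the tree here);
* `thm36i_rationallyStandard_Cpt/_Cpt_pf/_Cpt_rlf` — the typed schema (i) AT the three printed instances over
  `ptBase`, hypothesis-free;
* `Apt.not_isOfRationallyStandardType`, `Apt.isOfStandardType_and_not_isOfRationallyStandardType`,
  `thm36ii_standard_notRationallyStandard_Apt` — the same for (ii) at the angular Frobenioid `A_v`;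
* `not_forall_thm36i_rationallyStandard`, `not_forall_thm36ii_standard_notRationallyStandard` — the universal
  closures are FALSE (witnesses as above).
The general instance forms over an arbitrary connected, totally epimorphic base stay where they are
(`thm36i_rationallyStandard_C/_pf/_rlf`, `thm36ii_standard_notRationallyStandard_A`) and are not restated.
Nothing of the paper is contradicted; nothing here bears on [IUTchIII] Cor. 3.12; typed ≠ proved except
where a `theorem` says so.
-/

namespace Literature.AlgebraicGeometry.Frobenioids

open CategoryTheory

noncomputable section

namespace ArchFrd

/-! ### Theorem 3.6 (i), last clause, at `C_v`, `C_v^pf`, `C_v^rlf` over the one-morphism base — no hypothesis -/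

/-- **`C_v` (`Λ = ℤ`) over the one-morphism base `Spec ℂ` of [IUTchI] Ex. 3.4 (i) is of rationally standard
type** w.r.t. THE parameters of [FrdI] Def. 4.5 (iii) (`PreFrobenioid.rsParams Cpt.isFrobenioid PrimarySupp`),
with no hypothesis: abc-iut-L1-t9's `C.isOfRationallyStandardType_rsParams` with «connected» (`pt_isGraphConnected`),
«totally epimorphic» (`PadicFrd.isTotallyEpimorphic_discretePUnit`), «FSMFF» (`isOfFSMFFType_discretePUnit`) and
«RC-iso-subanchor» (`ptBase_isOfRCIsoSubanchorType`) discharged. [cite: MochizukiFrdII2008, Thm 3.6 (i) p.36] -/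
theorem Cpt.isOfRationallyStandardType :
    (PreFrobenioidData.ofFunctor (Φ ptBase) (C.toElem ptBase)).IsOfRationallyStandardType
      (PreFrobenioid.rsParams Cpt.isFrobenioid fun a 𝔭 => PrimarySupp a 𝔭) :=
  C.isOfRationallyStandardType_rsParams ptBase pt_isGraphConnected PadicFrd.isTotallyEpimorphic_discretePUnit
    isOfFSMFFType_discretePUnit ptBase_isOfRCIsoSubanchorType

/-- **[FrdII] Thm. 3.6 (i), last clause, `Λ = ℤ`, AS TYPED** (the schema `ArchFrd.Thm36i_rationallyStandard`)
at `C_v → F_Φ` over the one-morphism base `Spec ℂ` and THE Def. 4.5 (iii) parameters — FACT-LIST row F-0702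
at the instance consumed at archimedean places of [IUTchI]. [cite: MochizukiFrdII2008, Thm 3.6 (i) p.36] -/
theorem thm36i_rationallyStandard_Cpt :
    Literature.AlgebraicGeometry.Frobenioids.ArchFrd.Thm36i_rationallyStandard (baseRC ptBase) (C.toElem ptBase)
      (PreFrobenioid.rsParams Cpt.isFrobenioid fun a 𝔭 => PrimarySupp a 𝔭) :=
  thm36i_rationallyStandard_C ptBase pt_isGraphConnected PadicFrd.isTotallyEpimorphic_discretePUnit

/-- **`C_v^pf` (`Λ = ℚ`) over the one-morphism base is of rationally standard type** w.r.t. THE parameters,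
with no hypothesis (abc-iut-L1-t9's `thm36i_rationallyStandard_pf` via [FrdI] Prop. 5.5 (iii), antecedents
discharged at `ptBase`). [cite: MochizukiFrdII2008, Thm 3.6 (i) p.36] -/
theorem Cpt.pf_isOfRationallyStandardType :
    (PreFrobenioidData.ofFunctor _ (Thm36Sub.pfStr ptBase Cpt.isFrobenioid)).IsOfRationallyStandardType
      (PreFrobenioid.rsParams (C.pf_isFrobenioid ptBase Cpt.isFrobenioid) fun a 𝔭 => PrimarySupp a 𝔭) :=
  thm36i_rationallyStandard_pf ptBase pt_isGraphConnected PadicFrd.isTotallyEpimorphic_discretePUnit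
    isOfFSMFFType_discretePUnit ptBase_isOfRCIsoSubanchorType

/-- **[FrdII] Thm. 3.6 (i), last clause, `Λ = ℚ`, AS TYPED** at `C_v^pf → F_{Φ^pf}` over the one-morphism
base and THE parameters — hypothesis-free. [cite: MochizukiFrdII2008, Thm 3.6 (i) p.36] -/
theorem thm36i_rationallyStandard_Cpt_pf :
    Literature.AlgebraicGeometry.Frobenioids.ArchFrd.Thm36i_rationallyStandard (baseRC ptBase)
      (Thm36Sub.pfStr ptBase Cpt.isFrobenioid)
      (PreFrobenioid.rsParams (C.pf_isFrobenioid ptBase Cpt.isFrobenioid) fun a 𝔭 => PrimarySupp a 𝔭) :=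
  thm36i_rationallyStandard_pf ptBase pt_isGraphConnected PadicFrd.isTotallyEpimorphic_discretePUnit

/-- **`C_v^rlf` (`Λ = ℝ`) over the one-morphism base is of rationally standard type** w.r.t. THE parameters,
with no hypothesis (abc-iut-L1-t9's `thm36i_rationallyStandard_rlf` via [FrdI] Prop. 5.5 (iii), antecedents
discharged at `ptBase`). [cite: MochizukiFrdII2008, Thm 3.6 (i) p.36] -/
theorem Cpt.rlf_isOfRationallyStandardType :
    (PreFrobenioidData.ofFunctor _ (Thm36Sub.rlfStr ptBase)).IsOfRationallyStandardType
      (PreFrobenioid.rsParams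
        (Thm36Sub.rlf_isFrobenioid ptBase pt_isGraphConnected PadicFrd.isTotallyEpimorphic_discretePUnit)
        fun a 𝔭 => PrimarySupp a 𝔭) :=
  thm36i_rationallyStandard_rlf ptBase pt_isGraphConnected PadicFrd.isTotallyEpimorphic_discretePUnit
    isOfFSMFFType_discretePUnit ptBase_isOfRCIsoSubanchorType

/-- **[FrdII] Thm. 3.6 (i), last clause, `Λ = ℝ`, AS TYPED** at `C_v^rlf → F_{Φ^rlf}` over the one-morphism
base and THE parameters — hypothesis-free. [cite: MochizukiFrdII2008, Thm 3.6 (i) p.36] -/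
theorem thm36i_rationallyStandard_Cpt_rlf :
    Literature.AlgebraicGeometry.Frobenioids.ArchFrd.Thm36i_rationallyStandard (baseRC ptBase)
      (Thm36Sub.rlfStr ptBase)
      (PreFrobenioid.rsParams
        (Thm36Sub.rlf_isFrobenioid ptBase pt_isGraphConnected PadicFrd.isTotallyEpimorphic_discretePUnit)
        fun a 𝔭 => PrimarySupp a 𝔭) :=
  thm36i_rationallyStandard_rlf ptBase pt_isGraphConnected PadicFrd.isTotallyEpimorphic_discretePUnit

/-! ### Theorem 3.6 (ii), last clause, at the angular Frobenioid `A_v` over the one-morphism base — no hypothesis -/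

/-- **`A_v` over the one-morphism base `Spec ℂ` is NOT of rationally standard type** w.r.t. THE parameters
of [FrdI] Def. 4.5 (iii) (any support predicate `Supp`), with no hypothesis: abc-iut-L1-t9's
`A.not_isOfRationallyStandardType_rsParams` at `Apt.isFrobenioid` («`(A^un-tr)^birat` is of unit-trivial
type», FrdII p. 38 l. 39). [cite: MochizukiFrdII2008, Thm 3.6 (ii) p.37] -/
theorem Apt.not_isOfRationallyStandardType
    (Supp : ∀ {X : Discrete PUnit.{1}},
      (PreFrobenioidData.ofFunctor (zeroMonoid (Discrete PUnit.{1}) : (Discrete PUnit.{1})ᵒᵖ ⥤ CommMonCat.{0})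
          (A.toElem ptBase)).Mon X →
        Primes ((PreFrobenioidData.ofFunctor
          (zeroMonoid (Discrete PUnit.{1}) : (Discrete PUnit.{1})ᵒᵖ ⥤ CommMonCat.{0}) (A.toElem ptBase)).Mon X) →
          Prop) :
    ¬ (PreFrobenioidData.ofFunctor (zeroMonoid (Discrete PUnit.{1}) : (Discrete PUnit.{1})ᵒᵖ ⥤ CommMonCat.{0})
        (A.toElem ptBase)).IsOfRationallyStandardType (PreFrobenioid.rsParams Apt.isFrobenioid Supp) :=
  A.not_isOfRationallyStandardType_rsParams ptBase Apt.isFrobenioid Supp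

/-- **`A_v` over the one-morphism base is of standard but NOT of rationally standard type** (both conjuncts
of the last clause of Thm. 3.6 (ii) AT the instance, no hypothesis): abc-iut-w4-d027's `Apt.isOfStandardType`
and `Apt.not_isOfRationallyStandardType`. [cite: MochizukiFrdII2008, Thm 3.6 (ii) p.37] -/
theorem Apt.isOfStandardType_and_not_isOfRationallyStandardType
    (Supp : ∀ {X : Discrete PUnit.{1}},
      (PreFrobenioidData.ofFunctor (zeroMonoid (Discrete PUnit.{1}) : (Discrete PUnit.{1})ᵒᵖ ⥤ CommMonCat.{0})
          (A.toElem ptBase)).Mon X →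
        Primes ((PreFrobenioidData.ofFunctor
          (zeroMonoid (Discrete PUnit.{1}) : (Discrete PUnit.{1})ᵒᵖ ⥤ CommMonCat.{0}) (A.toElem ptBase)).Mon X) →
          Prop) :
    (PreFrobenioidData.ofFunctor (zeroMonoid (Discrete PUnit.{1}) : (Discrete PUnit.{1})ᵒᵖ ⥤ CommMonCat.{0})
        (A.toElem ptBase)).IsOfStandardType ∧
      ¬ (PreFrobenioidData.ofFunctor (zeroMonoid (Discrete PUnit.{1}) : (Discrete PUnit.{1})ᵒᵖ ⥤ CommMonCat.{0})
          (A.toElem ptBase)).IsOfRationallyStandardType (PreFrobenioid.rsParams Apt.isFrobenioid Supp) :=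
  ⟨Apt.isOfStandardType, Apt.not_isOfRationallyStandardType Supp⟩

/-- **[FrdII] Thm. 3.6 (ii), last clause, AS TYPED** (the schema `ArchFrd.Thm36ii_standard_notRationallyStandard`)
at the angular Frobenioid `A_v → F_0` over the one-morphism base `Spec ℂ` of [IUTchI] Ex. 3.4 (i) and THE
Def. 4.5 (iii) parameters (any `Supp`) — FACT-LIST row F-0703 at the consumed instance, hypothesis-free
(abc-iut-L1-t9's `thm36ii_standard_notRationallyStandard_A` with Ex. 3.3 (i)'s standing hypotheses discharged).
[cite: MochizukiFrdII2008, Thm 3.6 (ii) p.37] -/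
theorem thm36ii_standard_notRationallyStandard_Apt
    (Supp : ∀ {X : Discrete PUnit.{1}},
      (PreFrobenioidData.ofFunctor (zeroMonoid (Discrete PUnit.{1}) : (Discrete PUnit.{1})ᵒᵖ ⥤ CommMonCat.{0})
          (A.toElem ptBase)).Mon X →
        Primes ((PreFrobenioidData.ofFunctor
          (zeroMonoid (Discrete PUnit.{1}) : (Discrete PUnit.{1})ᵒᵖ ⥤ CommMonCat.{0}) (A.toElem ptBase)).Mon X) →
          Prop) :
    Literature.AlgebraicGeometry.Frobenioids.ArchFrd.Thm36ii_standard_notRationallyStandard (baseRC ptBase)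
      (A.toElem ptBase) (PreFrobenioid.rsParams Apt.isFrobenioid Supp) :=
  thm36ii_standard_notRationallyStandard_A ptBase pt_isGraphConnected PadicFrd.isTotallyEpimorphic_discretePUnit
    Supp

/-! ### The universal closures of the two schemata are false -/

/-- **The universal closure of the typed schema `ArchFrd.Thm36i_rationallyStandard G F R` is FALSE**
(FACT-LIST row F-0702, class R5). Witness: `D :=` the one-morphism category (FSMFF: `isOfFSMFFType_discretePUnit`),
`G := baseRC ptBase` (RC-iso-subanchor type: `ptBase_isOfRCIsoSubanchorType`), but `F := A_v → F_0` the ANGULAR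
Frobenioid with THE Def. 4.5 (iii) parameters, which is not rationally standard — i.e. the printed clause of
Thm. 3.6 (ii) refutes the closure of the schema of Thm. 3.6 (i), whose printed subject is `C^Λ`, not an
arbitrary `F`. The printed instances are `thm36i_rationallyStandard_C/_pf/_rlf` (every connected, totally
epimorphic base) and `thm36i_rationallyStandard_Cpt/_Cpt_pf/_Cpt_rlf` (hypothesis-free).
[cite: MochizukiFrdII2008, Thm 3.6 (i) p.36] -/
theorem not_forall_thm36i_rationallyStandard :
    ¬ ∀ (D : Type) [Category.{0} D] (G : D ⥤ ArchBase) (Φ : Dᵒᵖ ⥤ CommMonCat.{0})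
        (X : Type) [Category.{0} X] (F : X ⥤ ElemFrobenioid Φ)
        (R : PreFrobenioidData.RSParams.{0, 0, 0, 0, 0, 0} (PreFrobenioidData.ofFunctor Φ F)),
        Literature.AlgebraicGeometry.Frobenioids.ArchFrd.Thm36i_rationallyStandard G F R :=
  fun h =>
    Apt.not_isOfRationallyStandardType (fun _ _ => True)
      (h (Discrete PUnit.{1}) (baseRC ptBase) _ (A ptBase) (A.toElem ptBase)
        (PreFrobenioid.rsParams Apt.isFrobenioid fun _ _ => True)
        isOfFSMFFType_discretePUnit ptBase_isOfRCIsoSubanchorType)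

/-- **The universal closure of the typed schema `ArchFrd.Thm36ii_standard_notRationallyStandard G F R` is
FALSE** (FACT-LIST row F-0703, class R5). Witness: the one-morphism base as above, but `F := C_v → F_Φ` the
ARCHIMEDEAN Frobenioid with THE Def. 4.5 (iii) parameters, which IS rationally standard
(`Cpt.isOfRationallyStandardType`) — i.e. the printed clause of Thm. 3.6 (i) refutes the closure of the schema
of Thm. 3.6 (ii), whose printed subject is `A`, not an arbitrary `F`. The printed instances are
`thm36ii_standard_notRationallyStandard_A` (every connected, totally epimorphic base) and
`thm36ii_standard_notRationallyStandard_Apt` (hypothesis-free). [cite: MochizukiFrdII2008, Thm 3.6 (ii) p.37] -/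
theorem not_forall_thm36ii_standard_notRationallyStandard :
    ¬ ∀ (D : Type) [Category.{0} D] (G : D ⥤ ArchBase) (Φ : Dᵒᵖ ⥤ CommMonCat.{0})
        (X : Type) [Category.{0} X] (F : X ⥤ ElemFrobenioid Φ)
        (R : PreFrobenioidData.RSParams.{0, 0, 0, 0, 0, 0} (PreFrobenioidData.ofFunctor Φ F)),
        Literature.AlgebraicGeometry.Frobenioids.ArchFrd.Thm36ii_standard_notRationallyStandard G F R :=
  fun h =>
    (h (Discrete PUnit.{1}) (baseRC ptBase) _ (C ptBase) (C.toElem ptBase)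
        (PreFrobenioid.rsParams Cpt.isFrobenioid fun a 𝔭 => PrimarySupp a 𝔭)
        isOfFSMFFType_discretePUnit ptBase_isOfRCIsoSubanchorType).2
      Cpt.isOfRationallyStandardType

end ArchFrd

end

end Literature.AlgebraicGeometry.Frobenioids
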